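import Summits.CriticalPhenomena.PercolationContinuityZ3.Theorems.Transplant.SkelWinSeedKit
import Summits.CriticalPhenomena.PercolationContinuityZ3.Theorems.Transplant.SkelCylBall
import HarnessLib

/-!
# L5.5b (generic design-(D) re-typing) — the THICK SEED SLAB of a window level: the seed region of a contact is an induced-cylinder ball
# of half-width `ℓs` centred `ℓs` planar steps behind the contact's inner neighbour (ruling p3-g4 2026-08-20 18:39:38Z (A), refuter p5-g4
# 18:45:34Z, lead 18:47:45Z (2); SHEAR-SCOPE §3.9 L5.5 "reshape"; companion of the abstract kit `SkelWinSeedKit`; namespace `Transplant.SkelI`, `[DecidableEq V]` binder per the lane convention)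

builds on p205010 (kernel theorem, internal audit signed; external expert review pending) — nothing in this file uses p205010.
Lane `prim-bschramm`, seat `prim-bschramm-p1` (gen 7); helper file (`--supports stmt-CriticalPhenomena-4575 --as helper`).

For a candidate contact `x` of the window level `B⟨j⟩ = Win w₀ (Icc Lo Hi) R` (`Lo = lo - j`, `Hi = hi + j`) with inner neighbour
`y = inNbr x` (`φ y ∈ Icc Lo Hi`), the SLAB POINT `slabPt Lo Hi ℓs (φ y)` clamps `φ y` into the shrunk box `Icc (Lo + ℓs) (Hi - ℓs)` (so it
moves `φ y` by `≤ ℓs` in each coordinate when every side of the box is `≥ 2 ℓs`: the inward offset `ℓs` in the exit direction and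
Kozma–Nitzan's tangential window shift in the other), the SLAB CENTRE `slabCtr` is a vertex over the slab point at graph distance `≤ 2 ℓs`
from `y` (outward unit steps, `PlanarSkeleton.exists_mem_graphBall_φ_eq` with the field `step`), and the SEED REGION of a NEAR contact
(`y ∈ B_G(w₀, R - r₀)`) is the induced-cylinder ball `cylBallFin (slabCtr) ℓs R'` of p3-g4's `SkelCylBall` — connected through its centre,
inside `B⟨j⟩` (planar box `φ t + Λ_{ℓs} ⊆ Icc Lo Hi`, graph ball by `2 ℓs + R' ≤ r₀ ≤ R`), of size `≤ (Δ+1)^{R'}`, containing `y` as soon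
as `B_G(c, 2ℓs) ∩ cyl c ℓs ⊆ cylBall c ℓs R'` at every centre (`hR'`; discharged by p5-g4's type-uniform radius, `R' := cylRadMax ℓs ψ''`
with `ψ'' ≥ 2 ℓs`, `SkelCylRadFrame.prism_subset_cylBall`).  A FAR contact (`y ∉ B_G(w₀, R - r₀)`; **the fd-threshold of record is
`r₀`, any `r₀` with `2 ℓs + R' ≤ r₀ ≤ R`, enlarged by the cube's reach in L5.6**) gets the product's edge-contact remedy: region = face =
`{y}`, seed = the contact edge (`BoxProdZ2Collar`).  The face of a near contact is left ABSTRACT here (`Unear`, with the four `KitOK`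
face conditions as hypotheses `NearFaceOK`) until the fat prisms `Skel.fatSeq` (p3-g4, L4.1b) fix the cube behind the slab (L5.6).
* §1 `slabPt` (clamp) and its two inequalities; §2 `slabCtr`, `slabCtr_spec`; §3 `slabGeom` (the `KitGeom`), `NearFaceOK`;
* §5 `exitDir`/`exitDir_spec`/`φ_slabCtr_exitDir` (the inward normal for the cube behind the slab, p3-g4 19:11:29Z (1)),
  `φ_notMem_shrink_of_mem_slabS`, **`slabSeed_notMem_wireSet`** (Step V's `hSseed`: seeds off the pairs over the shrunk box
  `Icc (Lo + 2ℓs + 1) (Hi - 2ℓs - 1)` — the generic `kitSeed_notMem_wireSet`, shrink `2ℓs + 1` instead of `1`);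
* §4 **`kitOK_slab`**: `KitOK' Φ w₀ R lo hi j rs ((Φ.Δ+1)^R') cU (slabGeom …)` for `rs ≥ 2 ℓs + R' + 1` — hence, with `shyp_kit'`
  (`SkelSeedKitFace`: face vertices may lie in the region, as the far face `{y}` does),
  Kozma–Nitzan's Step-III axioms for the slab seeds of every window level.

[cite: KozmaNitzan2024, §4 Lemma 10, p. 19 (Step III, seeds), p. 21 (the window shift of v(P)) — the ℤ^d model] [cite: GrimmettPercolation1999, §7.2]
-/

noncomputable section

open scoped Classical

namespace Summit.CriticalPhenomena.PercolationContinuityZ3.Theorems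

namespace Transplant

namespace SkelI

open Literature.Probability.Percolation Literature.Probability.LatticeModels SimpleGraph KNLevels
open Literature.Barriers.CriticalPhenomena (graphBall graphBall_finite mem_graphBall_self graphBall_mono)
open BoxProdZ2 (ballFin mem_ballFin card_ballFin_le)
open Skel (winGraph winGraph_adj winLevel mem_winLevel_iff winLevel_monotone winLevel_subset_graphBall winLData winLData_X inNbr KitGeom
  cylBallFin mem_cylBallFin pathIn_cylBall' cylBall_subset_cyl)

variable {V : Type} {G : SimpleGraph V}

/-! ## §1 The slab point: clamping a planar point into the shrunk box -/

/-- **The slab point** of a planar point `z`: `z` clamped coordinatewise into the shrunk box `Icc (Lo + ℓ) (Hi - ℓ)`.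
[cite: KozmaNitzan2024, §4 p. 21 (the shift of v(P) along the face)] -/
def slabPt (Lo Hi : Site 2) (ℓ : ℕ) (z : Site 2) : Site 2 := fun i => max (Lo i + ℓ) (min (z i) (Hi i - ℓ))

/-- The slab point moves each coordinate of a point of the box by at most `ℓ` (box sides `≥ 2ℓ`). [folklore] -/
theorem abs_slabPt_sub_le {Lo Hi : Site 2} {ℓ : ℕ} (hwide : ∀ i, Lo i + 2 * ℓ ≤ Hi i) {z : Site 2} (hz : z ∈ Finset.Icc Lo Hi) (i : Fin 2) :
    |slabPt Lo Hi ℓ z i - z i| ≤ ℓ := by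
  rw [Finset.mem_Icc] at hz
  have h1 : Lo i ≤ z i := hz.1 i
  have h2 : z i ≤ Hi i := hz.2 i
  have h3 := hwide i
  simp only [slabPt, max_def, min_def]
  rw [abs_le]
  split_ifs <;> constructor <;> omega

/-- The box of half-width `ℓ` about the slab point lies in the box (box sides `≥ 2ℓ`). [folklore] -/
theorem add_mem_Icc_of_mem_box_slabPt {Lo Hi : Site 2} {ℓ : ℕ} (hwide : ∀ i, Lo i + 2 * ℓ ≤ Hi i) (z : Site 2) {b : Site 2}
    (hb : b ∈ box 2 ℓ) : slabPt Lo Hi ℓ z + b ∈ Finset.Icc Lo Hi := by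
  rw [mem_box] at hb
  rw [Finset.mem_Icc]
  constructor <;> intro i <;> have hbi := hb i <;> have h3 := hwide i <;> simp only [Pi.add_apply, slabPt, max_def, min_def] <;>
    split_ifs <;> omega

/-- The planar ℓ¹-distance from `z` to its slab point is at most `2ℓ`. [folklore] -/
theorem natAbs_slabPt_sub_add_le {Lo Hi : Site 2} {ℓ : ℕ} (hwide : ∀ i, Lo i + 2 * ℓ ≤ Hi i) {z : Site 2} (hz : z ∈ Finset.Icc Lo Hi) :
    (slabPt Lo Hi ℓ z 0 - z 0).natAbs + (slabPt Lo Hi ℓ z 1 - z 1).natAbs ≤ 2 * ℓ := by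
  have h0 := abs_slabPt_sub_le hwide hz 0
  have h1 := abs_slabPt_sub_le hwide hz 1
  rw [abs_le] at h0 h1
  omega

/-! ## §2 The slab centre behind a planar point -/

variable [G.LocallyFinite] (Φ : PlanarSkeletonConc G)

/-- **The slab centre** of a vertex `y` for the box `Icc Lo Hi`: a vertex over the slab point of `φ y`, within graph distance `2ℓ` of `y`
(a choice; outward unit steps). [cite: KozmaNitzan2024, §4 p. 21 (v(P))] -/
def slabCtr (Lo Hi : Site 2) (ℓ : ℕ) (y : V) : V :=
  Classical.choose (Φ.toPlanarSkeleton.exists_mem_graphBall_φ_eq Φ.step y (slabPt Lo Hi ℓ (Φ.φ y)))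

/-- Specification of the slab centre: within graph distance `2ℓ` of `y` (box sides `≥ 2ℓ`, `φ y` in the box), over the slab point.
[folklore] -/
theorem slabCtr_spec {Lo Hi : Site 2} {ℓ : ℕ} (hwide : ∀ i, Lo i + 2 * ℓ ≤ Hi i) {y : V} (hy : Φ.φ y ∈ Finset.Icc Lo Hi) :
    slabCtr Φ Lo Hi ℓ y ∈ graphBall G y (2 * ℓ) ∧ Φ.φ (slabCtr Φ Lo Hi ℓ y) = slabPt Lo Hi ℓ (Φ.φ y) := by
  have h := Classical.choose_spec (Φ.toPlanarSkeleton.exists_mem_graphBall_φ_eq Φ.step y (slabPt Lo Hi ℓ (Φ.φ y)))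
  exact ⟨graphBall_mono G y (natAbs_slabPt_sub_add_le hwide hy) h.1, h.2⟩

/-- `y` lies in the cylinder of half-width `ℓ` about its slab centre. [folklore] -/
theorem mem_cyl_slabCtr {Lo Hi : Site 2} {ℓ : ℕ} (hwide : ∀ i, Lo i + 2 * ℓ ≤ Hi i) {y : V} (hy : Φ.φ y ∈ Finset.Icc Lo Hi) :
    y ∈ Φ.toPlanarSkeleton.cyl (slabCtr Φ Lo Hi ℓ y) ℓ := by
  rw [PlanarSkeleton.mem_cyl, (slabCtr_spec Φ hwide hy).2, mem_box]
  intro i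
  have h := abs_slabPt_sub_le hwide hy i
  rw [abs_le] at h
  simp only [Pi.sub_apply]
  constructor <;> linarith [h.1, h.2]

/-- The cylinder of half-width `ℓ` about the slab centre has its skeleton coordinates in the box. [folklore] -/
theorem φ_mem_Icc_of_mem_cyl_slabCtr {Lo Hi : Site 2} {ℓ : ℕ} (hwide : ∀ i, Lo i + 2 * ℓ ≤ Hi i) {y : V} (hy : Φ.φ y ∈ Finset.Icc Lo Hi)
    {v : V} (hv : v ∈ Φ.toPlanarSkeleton.cyl (slabCtr Φ Lo Hi ℓ y) ℓ) : Φ.φ v ∈ Finset.Icc Lo Hi := by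
  rw [PlanarSkeleton.mem_cyl, (slabCtr_spec Φ hwide hy).2] at hv
  have h := add_mem_Icc_of_mem_box_slabPt hwide (Φ.φ y) hv
  rwa [add_sub_cancel] at h

/-! ## §3 The slab geometry of a window level -/

/-- **The slab seed geometry** of the window level `j` (`Lo = lo - j`, `Hi = hi + j`): inner neighbour `y = inNbr`; for a NEAR contact
(`y ∈ B_G(w₀, R - r₀)`) the region is the cylinder ball `cylBallFin (slabCtr y) ℓs R'` and the face is `Unear x`; for a FAR contact
region and face are `{y}` (edge-contact remedy). [cite: KozmaNitzan2024, §4 p. 19 (seeds)] -/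
def slabGeom (w₀ : V) (R : ℕ) (lo hi : Site 2) (j ℓs R' r₀ : ℕ) (Unear : V → Finset V) : KitGeom V where
  y := inNbr Φ w₀ R (Finset.Icc (lo - (j : Site 2)) (hi + (j : Site 2)))
  S := fun x =>
    if inNbr Φ w₀ R (Finset.Icc (lo - (j : Site 2)) (hi + (j : Site 2))) x ∈ graphBall G w₀ (R - r₀) then
      cylBallFin Φ (slabCtr Φ (lo - (j : Site 2)) (hi + (j : Site 2)) ℓs
        (inNbr Φ w₀ R (Finset.Icc (lo - (j : Site 2)) (hi + (j : Site 2))) x)) ℓs R'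
    else {inNbr Φ w₀ R (Finset.Icc (lo - (j : Site 2)) (hi + (j : Site 2))) x}
  U := fun x =>
    if inNbr Φ w₀ R (Finset.Icc (lo - (j : Site 2)) (hi + (j : Site 2))) x ∈ graphBall G w₀ (R - r₀) then Unear x
    else {inNbr Φ w₀ R (Finset.Icc (lo - (j : Site 2)) (hi + (j : Site 2))) x}

variable [DecidableEq V]

/-- **The face conditions of a near contact** (to be discharged by the cube behind the slab, L5.6): the face lies in `B⟨j⟩` and in
`B_G(x, rs)`, each face vertex has a `G`-neighbour in the slab region, and the face has at most `cU` vertices. [cite: KozmaNitzan2024, §4 p. 21 (U(P))] -/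
structure NearFaceOK (w₀ : V) (R : ℕ) (lo hi : Site 2) (j ℓs R' r₀ rs cU : ℕ) (Unear : V → Finset V) : Prop where
  sub : ∀ x ∈ outerBoundary (winGraph G w₀ R) (winLevel Φ w₀ R lo hi j),
    inNbr Φ w₀ R (Finset.Icc (lo - (j : Site 2)) (hi + (j : Site 2))) x ∈ graphBall G w₀ (R - r₀) → Unear x ⊆ winLevel Φ w₀ R lo hi j
  ball : ∀ x ∈ outerBoundary (winGraph G w₀ R) (winLevel Φ w₀ R lo hi j),
    inNbr Φ w₀ R (Finset.Icc (lo - (j : Site 2)) (hi + (j : Site 2))) x ∈ graphBall G w₀ (R - r₀) → ∀ u ∈ Unear x, u ∈ graphBall G x rs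
  adj : ∀ x ∈ outerBoundary (winGraph G w₀ R) (winLevel Φ w₀ R lo hi j),
    inNbr Φ w₀ R (Finset.Icc (lo - (j : Site 2)) (hi + (j : Site 2))) x ∈ graphBall G w₀ (R - r₀) → ∀ u ∈ Unear x,
      ∃ v ∈ Φ.cylBall (slabCtr Φ (lo - (j : Site 2)) (hi + (j : Site 2)) ℓs
        (inNbr Φ w₀ R (Finset.Icc (lo - (j : Site 2)) (hi + (j : Site 2))) x)) ℓs R', G.Adj v u
  card : ∀ x ∈ outerBoundary (winGraph G w₀ R) (winLevel Φ w₀ R lo hi j),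
    inNbr Φ w₀ R (Finset.Icc (lo - (j : Site 2)) (hi + (j : Site 2))) x ∈ graphBall G w₀ (R - r₀) → (Unear x).card ≤ cU
  one_le : 1 ≤ cU

/-! ## §4 The slab geometry satisfies the kit hypotheses -/

/-- Cylinder balls have at most `(Δ+1)^{R'}` vertices (they lie in the graph ball of radius `R'`). [folklore] -/
theorem card_cylBallFin_le (t : V) (ℓ R' : ℕ) : (cylBallFin Φ t ℓ R').card ≤ (Φ.Δ + 1) ^ R' := by
  refine le_trans (Finset.card_le_card fun v hv => ?_) (card_ballFin_le G Φ.degree_le t R')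
  rw [mem_cylBallFin] at hv
  exact (mem_ballFin G).2 (Φ.cylBall_subset_prism t ℓ R' hv).1

/-- **The slab geometry satisfies `KitOK`** with region size `(Δ+1)^{R'}` and reach `rs`, provided: every side of the level-`j` box is
`≥ 2 ℓs` (`hwide`), cylinder balls of radius `R'` swallow `B_G(c, 2ℓs) ∩ cyl c ℓs` at every centre (`hR'`, p5-g4's `cylRadMax`),
`2 ℓs + R' ≤ r₀ ≤ R`, `2 ℓs + R' + 1 ≤ rs`, and the near faces satisfy `NearFaceOK`. [cite: KozmaNitzan2024, §4 p. 19 (Step III)] -/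
theorem kitOK_slab {w₀ : V} {R : ℕ} {lo hi : Site 2} {j ℓs R' r₀ rs cU : ℕ} {Unear : V → Finset V}
    (hwide : ∀ i, (lo - (j : Site 2)) i + 2 * ℓs ≤ (hi + (j : Site 2)) i)
    (hR' : ∀ c : V, graphBall G c (2 * ℓs) ∩ Φ.toPlanarSkeleton.cyl c ℓs ⊆ Φ.cylBall c ℓs R')
    (hr₀ : 2 * ℓs + R' ≤ r₀) (hR : r₀ ≤ R) (hrs : 2 * ℓs + R' + 1 ≤ rs) (hU : NearFaceOK Φ w₀ R lo hi j ℓs R' r₀ rs cU Unear) :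
    KitOK Φ w₀ R lo hi j rs ((Φ.Δ + 1) ^ R') cU (slabGeom Φ w₀ R lo hi j ℓs R' r₀ Unear) := by
  -- abbreviations
  set Lo : Site 2 := lo - (j : Site 2) with hLo
  set Hi : Site 2 := hi + (j : Site 2) with hHi
  set K := outerBoundary (winGraph G w₀ R) (winLevel Φ w₀ R lo hi j) with hK
  have hKeq : winLevel Φ w₀ R lo hi j = Φ.Win w₀ (Finset.Icc Lo Hi) R := rfl
  -- the inner neighbour of a candidate contact
  have hy : ∀ x ∈ K, G.Adj x (inNbr Φ w₀ R (Finset.Icc Lo Hi) x) ∧ inNbr Φ w₀ R (Finset.Icc Lo Hi) x ∈ graphBall G w₀ R ∧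
      Φ.φ (inNbr Φ w₀ R (Finset.Icc Lo Hi) x) ∈ Finset.Icc Lo Hi := fun x hx => inNbr_spec Φ (by rwa [hK, hKeq] at hx)
  have hyW : ∀ x ∈ K, inNbr Φ w₀ R (Finset.Icc Lo Hi) x ∈ winLevel Φ w₀ R lo hi j := fun x hx =>
    (mem_winLevel_iff Φ).2 ⟨(hy x hx).2.1, (hy x hx).2.2⟩
  -- the slab region of a near contact: inside the level, near the contact, connected, small
  have hslab_sub : ∀ x ∈ K, inNbr Φ w₀ R (Finset.Icc Lo Hi) x ∈ graphBall G w₀ (R - r₀) →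
      ∀ v ∈ Φ.cylBall (slabCtr Φ Lo Hi ℓs (inNbr Φ w₀ R (Finset.Icc Lo Hi) x)) ℓs R', v ∈ winLevel Φ w₀ R lo hi j := by
    intro x hx hnear v hv
    rw [mem_winLevel_iff]
    refine ⟨?_, φ_mem_Icc_of_mem_cyl_slabCtr Φ hwide (hy x hx).2.2 (cylBall_subset_cyl Φ _ ℓs R' hv)⟩
    have h1 : v ∈ graphBall G (slabCtr Φ Lo Hi ℓs (inNbr Φ w₀ R (Finset.Icc Lo Hi) x)) R' := (Φ.cylBall_subset_prism _ ℓs R' hv).1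
    have h2 := (slabCtr_spec Φ hwide (hy x hx).2.2).1
    have h3 := BoxProdZ2.mem_graphBall_add G (BoxProdZ2.mem_graphBall_add G hnear h2) h1
    exact graphBall_mono G w₀ (by omega) h3
  have hslab_ball : ∀ x ∈ K, ∀ v ∈ Φ.cylBall (slabCtr Φ Lo Hi ℓs (inNbr Φ w₀ R (Finset.Icc Lo Hi) x)) ℓs R', v ∈ graphBall G x rs := by
    intro x hx v hv
    have h1 : v ∈ graphBall G (slabCtr Φ Lo Hi ℓs (inNbr Φ w₀ R (Finset.Icc Lo Hi) x)) R' := (Φ.cylBall_subset_prism _ ℓs R' hv).1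
    have h2 := (slabCtr_spec Φ hwide (hy x hx).2.2).1
    have h0 : inNbr Φ w₀ R (Finset.Icc Lo Hi) x ∈ graphBall G x 1 := BoxProdZ2.mem_graphBall_succ_of_adj G (mem_graphBall_self G x 0) (hy x hx).1
    have h3 := BoxProdZ2.mem_graphBall_add G (BoxProdZ2.mem_graphBall_add G h0 h2) h1
    exact graphBall_mono G x (by omega) h3
  have hy_cyl : ∀ x ∈ K, inNbr Φ w₀ R (Finset.Icc Lo Hi) x ∈
      Φ.cylBall (slabCtr Φ Lo Hi ℓs (inNbr Φ w₀ R (Finset.Icc Lo Hi) x)) ℓs R' := by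
    intro x hx
    refine hR' _ ⟨?_, mem_cyl_slabCtr Φ hwide (hy x hx).2.2⟩
    exact (BoxProdZ2.mem_graphBall_comm G).1 (slabCtr_spec Φ hwide (hy x hx).2.2).1
  refine ⟨fun x hx => (hy x hx).1, fun x hx => ?_, fun x hx => ?_, fun x hx => ?_, fun x hx => ?_, fun x hx => ?_, fun x hx => ?_,
    fun x hx => ?_, fun x hx => ?_, fun x hx => ?_⟩
  · -- y_mem
    show inNbr Φ w₀ R (Finset.Icc Lo Hi) x ∈ (slabGeom Φ w₀ R lo hi j ℓs R' r₀ Unear).S x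
    simp only [slabGeom]
    split_ifs with hnear
    · exact (mem_cylBallFin Φ).2 (hy_cyl x hx)
    · exact Finset.mem_singleton_self _
  · -- S_sub
    show (slabGeom Φ w₀ R lo hi j ℓs R' r₀ Unear).S x ⊆ winLevel Φ w₀ R lo hi j
    simp only [slabGeom]
    split_ifs with hnear
    · intro v hv; exact hslab_sub x hx hnear v ((mem_cylBallFin Φ).1 hv)
    · intro v hv; rw [Finset.mem_singleton] at hv; rw [hv]; exact hyW x hx
  · -- U_sub
    show (slabGeom Φ w₀ R lo hi j ℓs R' r₀ Unear).U x ⊆ winLevel Φ w₀ R lo hi j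
    simp only [slabGeom]
    split_ifs with hnear
    · exact hU.sub x hx hnear
    · intro v hv; rw [Finset.mem_singleton] at hv; rw [hv]; exact hyW x hx
  · -- S_ball
    show ∀ v ∈ (slabGeom Φ w₀ R lo hi j ℓs R' r₀ Unear).S x, v ∈ graphBall G x rs
    simp only [slabGeom]
    split_ifs with hnear
    · intro v hv; exact hslab_ball x hx v ((mem_cylBallFin Φ).1 hv)
    · intro v hv; rw [Finset.mem_singleton] at hv; rw [hv]
      exact graphBall_mono G x (by omega) (BoxProdZ2.mem_graphBall_succ_of_adj G (mem_graphBall_self G x 0) (hy x hx).1)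
  · -- U_ball
    show ∀ u ∈ (slabGeom Φ w₀ R lo hi j ℓs R' r₀ Unear).U x, u ∈ graphBall G x rs
    simp only [slabGeom]
    split_ifs with hnear
    · exact hU.ball x hx hnear
    · intro v hv; rw [Finset.mem_singleton] at hv; rw [hv]
      exact graphBall_mono G x (by omega) (BoxProdZ2.mem_graphBall_succ_of_adj G (mem_graphBall_self G x 0) (hy x hx).1)
  · -- S_path
    show ∀ v ∈ (slabGeom Φ w₀ R lo hi j ℓs R' r₀ Unear).S x,
      PathIn G ↑((slabGeom Φ w₀ R lo hi j ℓs R' r₀ Unear).S x) ((slabGeom Φ w₀ R lo hi j ℓs R' r₀ Unear).y x) v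
    simp only [slabGeom]
    split_ifs with hnear
    · intro v hv
      have h := pathIn_cylBall' Φ (hy_cyl x hx) ((mem_cylBallFin Φ).1 hv)
      have hcoe : (↑(cylBallFin Φ (slabCtr Φ Lo Hi ℓs (inNbr Φ w₀ R (Finset.Icc Lo Hi) x)) ℓs R') : Set V) =
          Φ.cylBall (slabCtr Φ Lo Hi ℓs (inNbr Φ w₀ R (Finset.Icc Lo Hi) x)) ℓs R' := by
        rw [cylBallFin, Set.Finite.coe_toFinset]
      rw [hcoe]
      exact h
    · intro v hv; rw [Finset.mem_singleton] at hv; rw [hv, Finset.coe_singleton]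
      exact PathIn.refl (Set.mem_singleton _)
  · -- U_adj (weak form: the far face `{y}` IS the region)
    show ∀ u ∈ (slabGeom Φ w₀ R lo hi j ℓs R' r₀ Unear).U x, u ∈ (slabGeom Φ w₀ R lo hi j ℓs R' r₀ Unear).S x ∨
      ∃ v ∈ (slabGeom Φ w₀ R lo hi j ℓs R' r₀ Unear).S x, G.Adj v u
    simp only [slabGeom]
    split_ifs with hnear
    · intro u hu
      obtain ⟨v, hv, hvu⟩ := hU.adj x hx hnear u hu
      exact Or.inr ⟨v, (mem_cylBallFin Φ).2 hv, hvu⟩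
    · intro u hu
      exact Or.inl hu
  · -- S_card
    show ((slabGeom Φ w₀ R lo hi j ℓs R' r₀ Unear).S x).card ≤ (Φ.Δ + 1) ^ R'
    simp only [slabGeom]
    split_ifs with hnear
    · exact card_cylBallFin_le Φ _ ℓs R'
    · rw [Finset.card_singleton]; exact Nat.one_le_pow _ _ (Nat.succ_pos _)
  · -- U_card
    show ((slabGeom Φ w₀ R lo hi j ℓs R' r₀ Unear).U x).card ≤ cU
    simp only [slabGeom]
    split_ifs with hnear
    · exact hU.card x hx hnear
    · rw [Finset.card_singleton]; exact hU.one_le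

/-! ## §5 The slab avoids the shell: seeds off the pairs of the shrunk box `Icc (Lo + 2ℓs + 1) (Hi - 2ℓs - 1)` -/

/-- **The inner neighbour of a contact sits on the boundary layer of the box**: some coordinate of `φ y` equals `Lo i` or `Hi i` (the
contact is outside the box and `φ` moves by at most one along the contact edge). [cite: KozmaNitzan2024, §4 p. 19 (x ∈ ∂B⟨j⟩)] -/
theorem exists_coord_eq_of_contact {w₀ : V} {R : ℕ} {Lo Hi : Site 2} {x : V}
    (hx : x ∈ outerBoundary (winGraph G w₀ R) (Φ.Win w₀ (Finset.Icc Lo Hi) R)) :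
    ∃ i : Fin 2, Φ.φ (inNbr Φ w₀ R (Finset.Icc Lo Hi) x) i = Lo i ∨ Φ.φ (inNbr Φ w₀ R (Finset.Icc Lo Hi) x) i = Hi i := by
  obtain ⟨hadj, -, hyP⟩ := inNbr_spec Φ hx
  have hxP : Φ.φ x ∉ Finset.Icc Lo Hi := ((mem_outerBoundary_win_iff Φ).1 hx).2.1
  by_contra hcon
  push Not at hcon
  apply hxP
  rw [Finset.mem_Icc] at hyP ⊢
  have key : ∀ i, Lo i ≤ Φ.φ x i ∧ Φ.φ x i ≤ Hi i := by
    intro i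
    have h1 := Φ.lip hadj i
    have h2 : Lo i < Φ.φ (inNbr Φ w₀ R (Finset.Icc Lo Hi) x) i := lt_of_le_of_ne (hyP.1 i) (Ne.symm (hcon i).1)
    have h3 : Φ.φ (inNbr Φ w₀ R (Finset.Icc Lo Hi) x) i < Hi i := lt_of_le_of_ne (hyP.2 i) (hcon i).2
    rw [abs_le] at h1
    constructor <;> linarith [h1.1, h1.2]
  exact ⟨fun i => (key i).1, fun i => (key i).2⟩

/-- **The exit datum `(i, σ)` of a contact**: a coordinate `i` in which the inner neighbour `y` sits on a face of the box, and the
outward sign `σ` of that face (`σ = 1`: `φ y i = Hi i`; `σ = -1`: `φ y i = Lo i`) — the inward normal along which the slab and the cube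
behind it are stacked (a choice; meaningful for contacts). [cite: KozmaNitzan2024, §4 p. 19 (x = y + e_i)] -/
def exitDir (w₀ : V) (R : ℕ) (Lo Hi : Site 2) (x : V) : Fin 2 × ℤˣ :=
  if h : ∃ i : Fin 2, Φ.φ (inNbr Φ w₀ R (Finset.Icc Lo Hi) x) i = Hi i then (Classical.choose h, 1)
  else if h' : ∃ i : Fin 2, Φ.φ (inNbr Φ w₀ R (Finset.Icc Lo Hi) x) i = Lo i then (Classical.choose h', -1) else (0, 1)

/-- Specification of the exit datum of a contact: `σ = 1` and `φ y i = Hi i`, or `σ = -1` and `φ y i = Lo i`. [folklore] -/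
theorem exitDir_spec {w₀ : V} {R : ℕ} {Lo Hi : Site 2} {x : V}
    (hx : x ∈ outerBoundary (winGraph G w₀ R) (Φ.Win w₀ (Finset.Icc Lo Hi) R)) :
    ((exitDir Φ w₀ R Lo Hi x).2 = 1 ∧ Φ.φ (inNbr Φ w₀ R (Finset.Icc Lo Hi) x) (exitDir Φ w₀ R Lo Hi x).1 = Hi (exitDir Φ w₀ R Lo Hi x).1) ∨
    ((exitDir Φ w₀ R Lo Hi x).2 = -1 ∧ Φ.φ (inNbr Φ w₀ R (Finset.Icc Lo Hi) x) (exitDir Φ w₀ R Lo Hi x).1 = Lo (exitDir Φ w₀ R Lo Hi x).1) := by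
  unfold exitDir
  by_cases h : ∃ i : Fin 2, Φ.φ (inNbr Φ w₀ R (Finset.Icc Lo Hi) x) i = Hi i
  · rw [dif_pos h]
    exact Or.inl ⟨rfl, Classical.choose_spec h⟩
  · rw [dif_neg h]
    have h' : ∃ i : Fin 2, Φ.φ (inNbr Φ w₀ R (Finset.Icc Lo Hi) x) i = Lo i := by
      obtain ⟨i, hi | hi⟩ := exists_coord_eq_of_contact Φ hx
      · exact ⟨i, hi⟩
      · exact absurd ⟨i, hi⟩ h
    rw [dif_pos h']
    exact Or.inr ⟨rfl, Classical.choose_spec h'⟩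

/-- **The slab centre sits `ℓs` inward from the contact's face**: in the exit coordinate, `φ (slabCtr y) i = φ y i - σ ℓs` (box sides
`≥ 2ℓs`). [cite: KozmaNitzan2024, §4 p. 21 (v(P))] -/
theorem φ_slabCtr_exitDir {w₀ : V} {R : ℕ} {Lo Hi : Site 2} {ℓs : ℕ} (hwide : ∀ i, Lo i + 2 * ℓs ≤ Hi i) {x : V}
    (hx : x ∈ outerBoundary (winGraph G w₀ R) (Φ.Win w₀ (Finset.Icc Lo Hi) R)) :
    Φ.φ (slabCtr Φ Lo Hi ℓs (inNbr Φ w₀ R (Finset.Icc Lo Hi) x)) (exitDir Φ w₀ R Lo Hi x).1 =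
      Φ.φ (inNbr Φ w₀ R (Finset.Icc Lo Hi) x) (exitDir Φ w₀ R Lo Hi x).1 - ((exitDir Φ w₀ R Lo Hi x).2 : ℤ) * ℓs := by
  have hyP := (inNbr_spec Φ hx).2.2
  rw [(slabCtr_spec Φ hwide hyP).2]
  have hw := hwide (exitDir Φ w₀ R Lo Hi x).1
  rcases exitDir_spec Φ hx with ⟨hσ, hface⟩ | ⟨hσ, hface⟩ <;> rw [hσ] <;> simp only [slabPt, max_def, min_def, Units.val_one,
    Units.val_neg, one_mul, neg_mul] <;> rw [hface] at * <;> split_ifs <;> omega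

/-- **Slab regions avoid the shrunk box**: every vertex of the region `S x` of the slab geometry has its skeleton coordinate OUTSIDE
`Icc (Lo + (2ℓs + 1)) (Hi - (2ℓs + 1))` (near contact: the cylinder about the slab centre spans inward depths `[0, 2ℓs]` in the exit
coordinate; far contact: the region is `{y}`, on the boundary layer). [cite: KozmaNitzan2024, §4 p. 21 ("Q ⊆ S": the cube sits behind the seed)] -/
theorem φ_notMem_shrink_of_mem_slabS {w₀ : V} {R : ℕ} {lo hi : Site 2} {j ℓs R' r₀ : ℕ} {Unear : V → Finset V}
    (hwide : ∀ i, (lo - (j : Site 2)) i + 2 * ℓs ≤ (hi + (j : Site 2)) i) {x : V}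
    (hx : x ∈ outerBoundary (winGraph G w₀ R) (winLevel Φ w₀ R lo hi j)) {v : V}
    (hv : v ∈ (slabGeom Φ w₀ R lo hi j ℓs R' r₀ Unear).S x) :
    Φ.φ v ∉ Finset.Icc (lo - (j : Site 2) + ((2 * ℓs + 1 : ℕ) : Site 2)) (hi + (j : Site 2) - ((2 * ℓs + 1 : ℕ) : Site 2)) := by
  set Lo : Site 2 := lo - (j : Site 2) with hLo
  set Hi : Site 2 := hi + (j : Site 2) with hHi
  have hx' : x ∈ outerBoundary (winGraph G w₀ R) (Φ.Win w₀ (Finset.Icc Lo Hi) R) := hx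
  obtain ⟨i, hi⟩ := exists_coord_eq_of_contact Φ hx'
  have hyP := (inNbr_spec Φ hx').2.2
  intro hmem
  rw [Finset.mem_Icc] at hmem
  have hm1 : (Lo + ((2 * ℓs + 1 : ℕ) : Site 2)) i ≤ Φ.φ v i := hmem.1 i
  have hm2 : Φ.φ v i ≤ (Hi - ((2 * ℓs + 1 : ℕ) : Site 2)) i := hmem.2 i
  simp only [Pi.add_apply, Pi.sub_apply, Pi.natCast_apply] at hm1 hm2
  push_cast at hm1 hm2
  have hw := hwide i
  have hy1 : Lo i ≤ Φ.φ (inNbr Φ w₀ R (Finset.Icc Lo Hi) x) i := (Finset.mem_Icc.1 hyP).1 i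
  have hy2 : Φ.φ (inNbr Φ w₀ R (Finset.Icc Lo Hi) x) i ≤ Hi i := (Finset.mem_Icc.1 hyP).2 i
  simp only [slabGeom] at hv
  split_ifs at hv with hnear
  · -- near: `v` in the cylinder about the slab centre
    have hcyl := cylBall_subset_cyl Φ _ ℓs R' ((mem_cylBallFin Φ).1 hv)
    rw [PlanarSkeleton.mem_cyl, (slabCtr_spec Φ hwide hyP).2, mem_box] at hcyl
    have hc : -(ℓs : ℤ) ≤ Φ.φ v i - slabPt Lo Hi ℓs (Φ.φ (inNbr Φ w₀ R (Finset.Icc Lo Hi) x)) i ∧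
        Φ.φ v i - slabPt Lo Hi ℓs (Φ.φ (inNbr Φ w₀ R (Finset.Icc Lo Hi) x)) i ≤ ℓs := hcyl i
    simp only [slabPt, max_def, min_def] at hc
    rcases hi with hi | hi <;> rw [hi] at hc <;> split_ifs at hc <;> omega
  · -- far: `v = y`
    rw [Finset.mem_singleton] at hv
    rw [hv] at hm1 hm2
    rcases hi with hi | hi <;> rw [hi] at hm1 hm2 <;> omega

/-- **Slab seeds avoid the pairs of the shell** (Step V's `hSseed`): for every `T` inside the window over the shrunk box
`Icc (Lo + 2ℓs + 1) (Hi - 2ℓs - 1)`, no seed edge of the slab geometry is a pair of `T`.  Generic twin of `BoxProdZ2.kitSeed_notMem_wireSet`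
(there with shrink `1`; here `2ℓs + 1`). [cite: KozmaNitzan2024, §4 p. 21 ("P_{K_ξ}(F_P) = P_G(F_P)")] -/
theorem slabSeed_notMem_wireSet {w₀ : V} {R : ℕ} {lo hi : Site 2} {j ℓs R' r₀ : ℕ} {Unear : V → Finset V}
    (hwide : ∀ i, (lo - (j : Site 2)) i + 2 * ℓs ≤ (hi + (j : Site 2)) i) {x : V}
    (hx : x ∈ outerBoundary (winGraph G w₀ R) (winLevel Φ w₀ R lo hi j)) {T : Set V}
    (hT : ∀ v ∈ T, Φ.φ v ∈ Finset.Icc (lo - (j : Site 2) + ((2 * ℓs + 1 : ℕ) : Site 2)) (hi + (j : Site 2) - ((2 * ℓs + 1 : ℕ) : Site 2)))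
    {e : Sym2 V} (he : e ∈ kitSeed G (slabGeom Φ w₀ R lo hi j ℓs R' r₀ Unear) x) : e ∉ wireSet T := by
  refine seed_notMem_wireSet (κ := slabGeom Φ w₀ R lo hi j ℓs R' r₀ Unear) (fun hxT => ?_)
    (fun v hv hvT => φ_notMem_shrink_of_mem_slabS Φ hwide hx hv (hT v hvT)) he
  -- the contact itself is outside the box, a fortiori outside the shrunk box
  have hxP : Φ.φ x ∉ Finset.Icc (lo - (j : Site 2)) (hi + (j : Site 2)) := ((mem_outerBoundary_win_iff Φ).1 hx).2.1
  apply hxP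
  have h := hT x hxT
  rw [Finset.mem_Icc] at h ⊢
  have key : ∀ i, (lo - (j : Site 2)) i ≤ Φ.φ x i ∧ Φ.φ x i ≤ (hi + (j : Site 2)) i := by
    intro i
    have h1 : (lo - (j : Site 2) + ((2 * ℓs + 1 : ℕ) : Site 2)) i ≤ Φ.φ x i := h.1 i
    have h2 : Φ.φ x i ≤ (hi + (j : Site 2) - ((2 * ℓs + 1 : ℕ) : Site 2)) i := h.2 i
    simp only [Pi.add_apply, Pi.sub_apply, Pi.natCast_apply] at h1 h2 ⊢
    push_cast at h1 h2 ⊢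
    constructor <;> omega
  exact ⟨fun i => (key i).1, fun i => (key i).2⟩

end SkelI

end Transplant

end Summit.CriticalPhenomena.PercolationContinuityZ3.Theorems

end
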